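import Literature.NumberTheory.PAdicHodge.DeRhamDescentModule
import Literature.NumberTheory.PAdicHodge.DualExpElliptic
import Literature.NumberTheory.EllipticCurves.TateModuleBaseChange
import Literature.NumberTheory.EllipticCurves.TateModuleFinite
import Literature.NumberTheory.GaloisRepresentations.SorensenPatchingHypotheses
import HarnessLib

/-!
# `V_pW|_{Γ_F}` in a tower `K₀ ⊆ F₀ ⊆ F` of fields and under base change `W ↦ W ×_{K₀} F`:
# de Rham-ness of the restricted Tate representation does not depend on the route

Topic `NumberTheory/PAdicHodge`; theorems only (no definition, no named fact, no instance).

The cite-only fact `isDeRham_restrictedRationalTateRep` (hDR, BSD crux K★ `stmt-BirchSwinnertonDyer-22226`) is about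
`restrictedRationalTateRep W F p = V_pW|_{Γ_F}` — the rational Tate representation of `W/K₀` restricted along the tree's
`absGaloisRestrict K₀ F : Γ_F → Γ_{K₀}` — for EVERY `p`-adic `K₀`-field `F`. Three pieces of bookkeeping reduce it to
statements about ONE field at a time:

* `GaloisRep.isAdmissible_restrictField_restrictField_iff` — for a tower `K₀ ⊆ F₀ ⊆ F` and ANY period-ring datum
  `𝔅` over `Γ_F`: `(ρ|_{Γ_{F₀}})|_{Γ_F}` is `𝔅`-admissible iff `ρ|_{Γ_F}` is (the two restriction maps `Γ_F → Γ_{K₀}`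
  differ by an inner automorphism, tree `SorensenPatching.exists_absGaloisRestrict_absGaloisRestrict_eq_conj`, and
  `ρ(τ)` intertwines; `isAdmissible_iff_of_equiv`);
* `isAdmissible_restrictedRationalTateRep_iff_baseChange` — `V_pW|_{Γ_F}` is `𝔅`-admissible iff `V_p(W ×_{K₀} F)` is
  (the equivariant isomorphism of Tate modules `rationalTateModuleEquiv`, tree `TateModuleBaseChange`);
* **`isDeRham_restrictedRationalTateRep_iff_of_tower`** — for `p`-adic fields `F₀ ⊆ F` over `K₀` with `F₀ → F`
  continuous (any `ℚ_p`-algebra structures): `V_pW|_{Γ_{F₀}}` is de Rham for `B_dR(F₀)` iff `V_pW|_{Γ_F}` is de Rham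
  for `B_dR(F)` (Brinon–Conrad 6.3.8 in the module dialect, `isDeRham_iff_isDeRham_restrictField`, + the tower lemma).
  In particular hDR for `W` at one `p`-adic field `F₀ ⊇ K₀` gives hDR at every finite extension of `F₀`, and hDR at
  a finite extension where `W` acquires semistable reduction descends.

## References

* [BrinonConrad2009] O. Brinon, B. Conrad, *CMI Summer School notes on p-adic Hodge theory* (2009), Prop. 6.3.8.
* [SilvermanAEC2009] J. H. Silverman, *AEC* (2009), III.§7, VII.§4 (`T_ℓ(E)` as a `Gal(K̄_v/K_v)`-module).
* [FontaineAsterisque223III] J.-M. Fontaine, Astérisque 223 (1994), Exp. III §1.5.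
-/

noncomputable section

open Field ValuativeRel

/-! ### Towers: `(ρ|_{Γ_{F₀}})|_{Γ_F}` versus `ρ|_{Γ_F}` -/

namespace Literature.NumberTheory.GaloisRepresentations.GaloisRep

universe v w w'

variable {K₀ F₀ F : Type} [Field K₀] [Field F₀] [Field F] [Algebra K₀ F₀] [Algebra F₀ F] [Algebra K₀ F]
  [IsScalarTower K₀ F₀ F]
  {P : Type v} [Field P] [TopologicalSpace P] [Algebra P F]
  {M : Type w'} [AddCommGroup M] [Module P M] [TopologicalSpace M]

/-- **Restriction along a tower is restriction, up to isomorphism**: for `K₀ ⊆ F₀ ⊆ F` and a period-ring datum `𝔅`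
over `Γ_F`, `(ρ|_{Γ_{F₀}})|_{Γ_F}` is `𝔅`-admissible iff `ρ|_{Γ_F}` is — the composite `Γ_F → Γ_{F₀} → Γ_{K₀}` and
`Γ_F → Γ_{K₀}` differ by conjugation by some `τ ∈ Γ_{K₀}`, and `ρ(τ)` is an equivariant isomorphism between the two
restrictions. [cite: FontaineAsterisque223III, Exp. III §1.5] -/
theorem isAdmissible_restrictField_restrictField_iff
    (𝔅 : PeriodRingData.{0, v, 0, w} (absoluteGaloisGroup F) P F) (ρ : GaloisRep K₀ P M) :
    𝔅.IsAdmissible ((ρ.restrictField F₀).restrictField F) ↔ 𝔅.IsAdmissible (ρ.restrictField F) := by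
  obtain ⟨τ, hτ⟩ := SorensenPatching.exists_absGaloisRestrict_absGaloisRestrict_eq_conj K₀ F₀ F
  -- `e = ρ(τ)` intertwines `ρ|_{Γ_F}` with `(ρ|_{Γ_{F₀}})|_{Γ_F}`
  let e : M ≃ₗ[P] M := LinearEquiv.ofLinear (ρ τ) (ρ τ⁻¹)
    (by rw [← Module.End.mul_eq_comp, ← map_mul, mul_inv_cancel, map_one]; rfl)
    (by rw [← Module.End.mul_eq_comp, ← map_mul, inv_mul_cancel, map_one]; rfl)
  refine (𝔅.isAdmissible_iff_of_equiv (ρ.restrictField F) ((ρ.restrictField F₀).restrictField F) e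
    fun σ x => ?_).symm
  change ρ τ (ρ (absGaloisRestrict K₀ F σ) x) = ρ (absGaloisRestrict K₀ F₀ (absGaloisRestrict F₀ F σ)) (ρ τ x)
  rw [hτ σ, map_mul, map_mul, Module.End.mul_apply, Module.End.mul_apply, ← Module.End.mul_apply (ρ τ⁻¹),
    ← map_mul, inv_mul_cancel, map_one, Module.End.one_apply]

end Literature.NumberTheory.GaloisRepresentations.GaloisRep

namespace Literature.NumberTheory.PAdicHodge

open Literature.NumberTheory.GaloisRepresentations
open Literature.NumberTheory.GaloisRepresentations.IsNonarchimedeanLocalField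
open Literature.NumberTheory.EllipticCurves WeierstrassCurve

/-! ### Base change: `V_pW|_{Γ_F}` versus `V_p(W ×_{K₀} F)` -/

section BaseChange

universe v w

variable {K₀ : Type} [Field K₀] [CharZero K₀] (W : WeierstrassCurve K₀) [W.IsElliptic]
  {F : Type} [Field F] [Algebra K₀ F] {p : ℕ} [Fact p.Prime] [Algebra ℚ_[p] F]

/-- **`V_pW|_{Γ_F}` is `𝔅`-admissible iff `V_p(W ×_{K₀} F)` is**, for any period-ring datum `𝔅` over `Γ_F` with
coefficients `ℚ_p`: the tree's equivariant isomorphism of rational Tate modules `rationalTateModuleEquiv W F p`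
(`T_p(W)|_{Γ_F} ≅ T_p(W ×_{K₀} F)`, Silverman VII.§4). [cite: SilvermanAEC2009, III.§7 and VII.§4] -/
theorem isAdmissible_restrictedRationalTateRep_iff_baseChange [TopologicalSpace F]
    (𝔅 : PeriodRingData.{0, 0, 0, w} (absoluteGaloisGroup F) ℚ_[p] F) :
    𝔅.IsAdmissible (restrictedRationalTateRep W F p) ↔ 𝔅.IsAdmissible (rationalTateRep (W.baseChange F) p) :=
  𝔅.isAdmissible_iff_of_equiv (restrictedRationalTateRep W F p) (rationalTateRep (W.baseChange F) p)
    (rationalTateModuleEquiv W F p) fun σ x => rationalTateModuleEquiv_rationalGaloisRepTate W F p σ x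

end BaseChange

/-! ### Towers of `p`-adic fields: hDR at `F₀` iff hDR at `F` -/

variable {K₀ : Type} [Field K₀] (W : WeierstrassCurve K₀) [W.IsElliptic]
  {F₀ F : Type} [Field F₀] [ValuativeRel F₀] [TopologicalSpace F₀] [IsNonarchimedeanLocalField F₀] [CharZero F₀]
  [Field F] [ValuativeRel F] [TopologicalSpace F] [IsNonarchimedeanLocalField F] [CharZero F]
  [Algebra K₀ F₀] [Algebra F₀ F] [Algebra K₀ F] [IsScalarTower K₀ F₀ F] {p : ℕ} [Fact p.Prime]
  [Fact (¬ IsUnit ((p : ℕ) : integerC F₀))] [IsAdicComplete (Ideal.span {((p : ℕ) : integerC F₀)}) (integerC F₀)]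
  [Fact (¬ IsUnit ((p : ℕ) : integerC F))] [IsAdicComplete (Ideal.span {((p : ℕ) : integerC F)}) (integerC F)]
  [Algebra ℚ_[p] F₀] [Algebra ℚ_[p] F]

/-- **hDR at `F₀` iff hDR at `F`, for `F₀ → F` a continuous embedding of `p`-adic fields over `K₀`**:
`V_pW|_{Γ_{F₀}}` is de Rham for `B_dR(F₀)` iff `V_pW|_{Γ_F}` is de Rham for `B_dR(F)` (Brinon–Conrad 6.3.8 in the module
dialect, `isDeRham_iff_isDeRham_restrictField`, and the tower lemma). [cite: BrinonConrad2009, Prop. 6.3.8] -/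
theorem isDeRham_restrictedRationalTateRep_iff_of_tower (hcont : Continuous (algebraMap F₀ F))
    (hp₀ : valuation F₀ (p : F₀) < 1) (hp : valuation F (p : F) < 1) :
    GaloisRep.IsDeRham (bdRPeriodRingData (F := F₀) (p := p) hp₀) (restrictedRationalTateRep W F₀ p) ↔
      GaloisRep.IsDeRham (bdRPeriodRingData (F := F) (p := p) hp) (restrictedRationalTateRep W F p) := by
  haveI : Module.Finite ℚ_[p] (W.rationalTateModule p) := W.finite_rationalTateModule p
  have h1 := isDeRham_iff_isDeRham_restrictField (K := F₀) (L := F) hcont hp₀ hp (restrictedRationalTateRep W F₀ p)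
  rw [h1]
  exact GaloisRep.isAdmissible_restrictField_restrictField_iff (K₀ := K₀) (F₀ := F₀) (F := F)
    (bdRPeriodRingData (F := F) (p := p) hp) (W.rationalTateGaloisRep p (W.continuous_rationalGaloisRepTate_holds p))

/-- **Ascent of hDR along `F₀ → F`**. [cite: BrinonConrad2009, Prop. 6.3.8] -/
theorem isDeRham_restrictedRationalTateRep_of_tower (hcont : Continuous (algebraMap F₀ F))
    (hp₀ : valuation F₀ (p : F₀) < 1) (hp : valuation F (p : F) < 1)
    (h : GaloisRep.IsDeRham (bdRPeriodRingData (F := F₀) (p := p) hp₀) (restrictedRationalTateRep W F₀ p)) :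
    GaloisRep.IsDeRham (bdRPeriodRingData (F := F) (p := p) hp) (restrictedRationalTateRep W F p) :=
  (isDeRham_restrictedRationalTateRep_iff_of_tower W hcont hp₀ hp).1 h

/-- **Descent of hDR along `F₀ → F`** (e.g. from a finite extension over which `W` acquires semistable reduction).
[cite: BrinonConrad2009, Prop. 6.3.8] -/
theorem isDeRham_restrictedRationalTateRep_of_tower_descent (hcont : Continuous (algebraMap F₀ F))
    (hp₀ : valuation F₀ (p : F₀) < 1) (hp : valuation F (p : F) < 1)
    (h : GaloisRep.IsDeRham (bdRPeriodRingData (F := F) (p := p) hp) (restrictedRationalTateRep W F p)) :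
    GaloisRep.IsDeRham (bdRPeriodRingData (F := F₀) (p := p) hp₀) (restrictedRationalTateRep W F₀ p) :=
  (isDeRham_restrictedRationalTateRep_iff_of_tower W hcont hp₀ hp).2 h

end Literature.NumberTheory.PAdicHodge

end
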